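import Mathlib
import Literature.Geometry.DiscreteGeometry.KissingNumberThreeProofs
import HarnessLib

/-!
# Route EnergyDerivativeOrder — item `GappedKissingBound`: the bond-degree lemma

Helper file for `stmt-AtomisticToContinuum-12281`
(`Summit.AtomisticToContinuum.Crystallization.Theses.EnergyDerivativeOrder.GappedKissingBound`).

Setting ("gapped spherical code"): a finite family of unit vectors `u p` (`p ∈ T`) of `ℝ³` whose
pairwise inner products are either `≤ 1/50` ("far", angle `≥ 88.85°`) or in `[247/500, 253/500]`
("bond", angle `60° ± 0.4°`). This file proves the local fact every point has AT MOST FOUR bonds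
(`gkb_bond_card_le_four`): the bonded neighbours `w` of `e` project to the plane `e^⊥` (complex
coordinate `z` of `Musin.exists_complex_coord`) with azimuthal separations `φ` satisfying
`cos φ < cos (3π/8)` always, and `cos φ > cos (2π/5)` (bond) or `cos φ < 0` (far); five sorted
azimuths would have five cyclic gaps `> 3π/8` each, all `< 2π/5` or one `> π/2`, and neither is
compatible with the gaps summing to `2π` (`gkb_five_gaps_false`).  The counting (linear-programming)
half of the bound is in `EnergyDerivativeOrderGappedKissingBound.lean`.
-/

noncomputable section

namespace Summit.AtomisticToContinuum.Crystallization.Theorems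

open Real Finset
open scoped RealInnerProductSpace

/-! ### Two cosine values -/

/-- `cos (2π/5) = (√5 − 1)/4 < 0.3091`. [folklore] -/
theorem gkb_cos_two_pi_div_five_lt : Real.cos (2 * π / 5) < 0.3091 := by
  have h : 2 * π / 5 = 2 * (π / 5) := by ring
  rw [h, Real.cos_two_mul, Real.cos_pi_div_five]
  have h5 : (√5 : ℝ) ^ 2 = 5 := Real.sq_sqrt (by norm_num)
  have h5' : (√5 : ℝ) < 2.2364 := by
    rw [Real.sqrt_lt' (by norm_num)]; norm_num
  nlinarith

/-- `cos (3π/8) = sin (π/8) = √(2 − √2)/2 > 0.38`. [folklore] -/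
theorem gkb_lt_cos_three_pi_div_eight : (0.38 : ℝ) < Real.cos (3 * π / 8) := by
  have h : 3 * π / 8 = π / 2 - π / 8 := by ring
  rw [h, Real.cos_pi_div_two_sub, Real.sin_pi_div_eight]
  have h2 : Real.sqrt 2 < 1.42 := by
    rw [Real.sqrt_lt' (by norm_num)]; norm_num
  have h3 : (0.76 : ℝ) < √(2 - √2) := by
    rw [Real.lt_sqrt (by norm_num)]; linarith
  linarith

/-! ### Cyclic gaps -/

/-- A gap `g ∈ (0, 2π)` with `cos g < cos (3π/8)` exceeds `3π/8`. [folklore] -/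
theorem gkb_gap_lower {g : ℝ} (h0 : 0 < g) (hc : Real.cos g < Real.cos (3 * π / 8)) : 3 * π / 8 < g := by
  by_contra h
  push Not at h
  have := Real.cos_le_cos_of_nonneg_of_le_pi h0.le (by linarith [Real.pi_pos]) h
  linarith

/-- A positive gap with `cos g < 0` exceeds `π/2`. [folklore] -/
theorem gkb_gap_big {g : ℝ} (h0 : 0 < g) (hc : Real.cos g < 0) : π / 2 < g := by
  by_contra h
  push Not at h
  have := Real.cos_nonneg_of_neg_pi_div_two_le_of_le (by linarith [Real.pi_pos]) h
  linarith

/-- A gap `g ≤ 8π/5` with `cos (2π/5) < cos g` is `< 2π/5`; stated as a dichotomy. [folklore] -/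
theorem gkb_gap_small {g : ℝ} (hc : Real.cos (2 * π / 5) < Real.cos g) :
    g < 2 * π / 5 ∨ 8 * π / 5 < g := by
  by_contra h
  push Not at h
  obtain ⟨ha, hb⟩ := h
  rcases le_total g π with hg | hg
  · have := Real.cos_le_cos_of_nonneg_of_le_pi (by positivity) hg ha
    linarith
  · have h' : Real.cos g = Real.cos (2 * π - g) := by rw [Real.cos_two_pi_sub]
    have := Real.cos_le_cos_of_nonneg_of_le_pi (x := 2 * π / 5) (y := 2 * π - g) (by positivity)
      (by linarith) (by linarith)
    linarith

/-- **Five azimuths are too many.** Five sorted azimuths in `(-π, π]` whose pairwise differences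
`φ` all satisfy `cos φ < cos (3π/8)` and (`cos φ > cos (2π/5)` or `cos φ < 0`) do not exist: the
five cyclic gaps sum to `2π`, each exceeds `3π/8`, and either one exceeds `π/2`
(`π/2 + 4 · 3π/8 = 2π`) or all are `< 2π/5`. [folklore] -/
theorem gkb_five_gaps_false {θ : Fin 5 → ℝ} (hθ : StrictMono θ) (hr : ∀ i, -π < θ i ∧ θ i ≤ π)
    (hsmall : ∀ i j, i ≠ j → Real.cos (θ i - θ j) < Real.cos (3 * π / 8))
    (hdich : ∀ i j, i ≠ j → Real.cos (2 * π / 5) < Real.cos (θ i - θ j) ∨ Real.cos (θ i - θ j) < 0) :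
    False := by
  have h01 : θ 0 < θ 1 := hθ (by decide)
  have h12 : θ 1 < θ 2 := hθ (by decide)
  have h23 : θ 2 < θ 3 := hθ (by decide)
  have h34 : θ 3 < θ 4 := hθ (by decide)
  have hπ := Real.pi_pos
  have h0 := hr 0
  have h4 := hr 4
  -- the wrap-around gap
  set g4 := 2 * π - (θ 4 - θ 0) with hg4
  have hc4 : Real.cos g4 = Real.cos (θ 4 - θ 0) := by rw [hg4, Real.cos_two_pi_sub]
  have g4pos : 0 < g4 := by rw [hg4]; linarith
  -- lower bounds `> 3π/8`
  have l0 := gkb_gap_lower (g := θ 1 - θ 0) (by linarith) (hsmall 1 0 (by decide))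
  have l1 := gkb_gap_lower (g := θ 2 - θ 1) (by linarith) (hsmall 2 1 (by decide))
  have l2 := gkb_gap_lower (g := θ 3 - θ 2) (by linarith) (hsmall 3 2 (by decide))
  have l3 := gkb_gap_lower (g := θ 4 - θ 3) (by linarith) (hsmall 4 3 (by decide))
  have l4 := gkb_gap_lower (g := g4) g4pos (by rw [hc4]; exact hsmall 4 0 (by decide))
  -- dichotomy for each gap
  have d0 := hdich 1 0 (by decide)
  have d1 := hdich 2 1 (by decide)
  have d2 := hdich 3 2 (by decide)
  have d3 := hdich 4 3 (by decide)
  have d4 := hdich 4 0 (by decide)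
  rw [← hc4] at d4
  rcases d0 with d0 | d0
  swap; · have := gkb_gap_big (by linarith) d0; linarith
  rcases d1 with d1 | d1
  swap; · have := gkb_gap_big (by linarith) d1; linarith
  rcases d2 with d2 | d2
  swap; · have := gkb_gap_big (by linarith) d2; linarith
  rcases d3 with d3 | d3
  swap; · have := gkb_gap_big (by linarith) d3; linarith
  rcases d4 with d4 | d4
  swap; · have := gkb_gap_big g4pos d4; linarith
  rcases gkb_gap_small d0 with e0 | e0
  swap; · linarith [(hr 1).2, (hr 0).1]
  rcases gkb_gap_small d1 with e1 | e1
  swap; · linarith [(hr 2).2, (hr 1).1]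
  rcases gkb_gap_small d2 with e2 | e2
  swap; · linarith [(hr 3).2, (hr 2).1]
  rcases gkb_gap_small d3 with e3 | e3
  swap; · linarith [(hr 4).2, (hr 3).1]
  rcases gkb_gap_small d4 with e4 | e4
  swap; · linarith
  linarith

/-! ### The bond-degree lemma -/

/-- Height of a bonded partner controls the norm of its projection: `n² = 1 − a²`,
`a ∈ [0.494, 0.506]` gives `n ∈ [0.8625, 0.8695]`. [folklore] -/
theorem gkb_proj_norm_bounds {n a : ℝ} (hn0 : 0 ≤ n) (h : n ^ 2 = 1 - a ^ 2)
    (ha1 : (247 : ℝ) / 500 ≤ a) (ha2 : a ≤ 253 / 500) : 0.8625 ≤ n ∧ n ≤ 0.8695 := by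
  constructor
  · nlinarith
  · nlinarith

/-- Product of two numbers in `[0.8625, 0.8695]`. [folklore] -/
theorem gkb_proj_prod_bounds {n n' : ℝ} (h1 : 0.8625 ≤ n) (h2 : n ≤ 0.8695) (h1' : 0.8625 ≤ n')
    (h2' : n' ≤ 0.8695) : 0.7439 ≤ n' * n ∧ n' * n ≤ 0.7561 := by
  constructor
  · nlinarith
  · nlinarith

/-- Product of two heights in `[0.494, 0.506]`. [folklore] -/
theorem gkb_height_prod_bounds {a a' : ℝ} (h1 : (247 : ℝ) / 500 ≤ a) (h2 : a ≤ 253 / 500)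
    (h1' : (247 : ℝ) / 500 ≤ a') (h2' : a' ≤ 253 / 500) :
    0.244036 ≤ a' * a ∧ a' * a ≤ 0.256036 := by
  constructor
  · nlinarith
  · nlinarith

/-- `P C ≤ 0.262` with `P ≥ 0.7439` forces `C < 0.36`. [folklore] -/
theorem gkb_cos_lt_of_mul_le {P C : ℝ} (hP : 0.7439 ≤ P) (h : P * C ≤ 0.262) : C < 0.36 := by
  by_contra hc
  push Not at hc
  have := mul_le_mul_of_nonneg_left hc (by linarith : (0 : ℝ) ≤ P)
  nlinarith

/-- `P C < 0` with `P ≥ 0` forces `C < 0`. [folklore] -/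
theorem gkb_cos_neg_of_mul_neg {P C : ℝ} (hP : 0 ≤ P) (h : P * C < 0) : C < 0 := by
  by_contra hc
  push Not at hc
  have := mul_nonneg hP hc
  linarith

/-- `P C ≥ 0.2379` with `0 ≤ P ≤ 0.7561` forces `C > 0.3091`. [folklore] -/
theorem gkb_lt_cos_of_le_mul {P C : ℝ} (hP0 : 0 ≤ P) (hP : P ≤ 0.7561) (h : 0.2379 ≤ P * C) :
    0.3091 < C := by
  by_contra hc
  push Not at hc
  have := mul_le_mul_of_nonneg_left hc hP0
  nlinarith

/-- **At most four bonds per point.** In a finite family of unit vectors of `ℝ³` whose pairwise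
inner products are `≤ 1/50` or in `[247/500, 253/500]`, every member `u y` has at most four
bonded partners (`⟪u y, u x⟫ ≥ 247/500`, `x ≠ y`). Proof: complex coordinate `z` on `(u y)^⊥`
(`Musin.exists_complex_coord`); for bonded partners `w, w'` with heights `a, a' ∈ [0.494, 0.506]`
one has `‖z w‖² = 1 − a²` and `‖z w'‖ ‖z w‖ cos(Δarg) = ⟪w', w⟫ − a' a`, whence the hypotheses of
`gkb_five_gaps_false` for any five of them sorted by azimuth. [folklore] -/
theorem gkb_bond_card_le_four {ι : Type*} [DecidableEq ι] (T : Finset ι)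
    (u : ι → EuclideanSpace ℝ (Fin 3)) (h1 : ∀ p ∈ T, ‖u p‖ = 1)
    (hA : ∀ p ∈ T, ∀ q ∈ T, p ≠ q →
      ⟪u p, u q⟫ ≤ 1 / 50 ∨ (247 / 500 ≤ ⟪u p, u q⟫ ∧ ⟪u p, u q⟫ ≤ 253 / 500))
    (y : ι) (hy : y ∈ T) :
    ((T.erase y).filter (fun x => (247 : ℝ) / 500 ≤ ⟪u y, u x⟫)).card ≤ 4 := by
  classical
  by_contra hlt
  push Not at hlt
  obtain ⟨S, hSsub, hScard⟩ := Finset.exists_subset_card_eq (show 5 ≤ _ from hlt)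
  have he : ‖u y‖ = 1 := h1 y hy
  obtain ⟨z, hz⟩ := Literature.Geometry.DiscreteGeometry.Musin.exists_complex_coord (u y) he
  -- what membership in `S` gives
  have hS : ∀ x ∈ S, x ∈ T ∧ x ≠ y ∧ (247 : ℝ) / 500 ≤ ⟪u y, u x⟫ ∧ ⟪u y, u x⟫ ≤ 253 / 500 := by
    intro x hx
    have hx' := hSsub hx
    rw [Finset.mem_filter] at hx'
    obtain ⟨hxe, hxb⟩ := hx'
    have hxT := Finset.mem_of_mem_erase hxe
    have hxy := Finset.ne_of_mem_erase hxe
    refine ⟨hxT, hxy, hxb, ?_⟩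
    rcases hA y hy x hxT hxy.symm with h | h
    · linarith
    · exact h.2
  have hnz : ∀ x ∈ S, ‖z (u x)‖ ^ 2 = 1 - ⟪u y, u x⟫ ^ 2 := fun x hx => by
    rw [← real_inner_self_eq_norm_sq, hz, real_inner_self_eq_norm_sq, h1 _ (hS x hx).1]; ring
  -- the two facts about azimuthal separations of bonded partners
  have hpair : ∀ x ∈ S, ∀ x' ∈ S, x ≠ x' →
      Real.cos (Complex.arg (z (u x)) - Complex.arg (z (u x'))) < Real.cos (3 * π / 8) ∧
      (Real.cos (2 * π / 5) < Real.cos (Complex.arg (z (u x)) - Complex.arg (z (u x'))) ∨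
        Real.cos (Complex.arg (z (u x)) - Complex.arg (z (u x'))) < 0) := by
    intro x hx x' hx' hne
    obtain ⟨hxT, -, hax1, hax2⟩ := hS x hx
    obtain ⟨hxT', -, hax1', hax2'⟩ := hS x' hx'
    have hn2 := hnz x hx
    have hn2' := hnz x' hx'
    have hww := hA x' hxT' x hxT hne.symm
    have key : ⟪z (u x'), z (u x)⟫ =
        ‖z (u x')‖ * ‖z (u x)‖ * Real.cos (Complex.arg (z (u x)) - Complex.arg (z (u x'))) := by
      rw [Complex.inner]
      exact Literature.Geometry.DiscreteGeometry.Musin.re_mul_conj_eq_cos_arg (z (u x')) (z (u x))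
    rw [hz (u x') (u x)] at key
    set a := ⟪u y, u x⟫ with ha
    set a' := ⟪u y, u x'⟫ with ha'
    set n := ‖z (u x)‖ with hn
    set n' := ‖z (u x')‖ with hn'
    set C := Real.cos (Complex.arg (z (u x)) - Complex.arg (z (u x'))) with hC
    have hn0 : 0 ≤ n := norm_nonneg _
    have hn0' : 0 ≤ n' := norm_nonneg _
    obtain ⟨hn_l, hn_u⟩ := gkb_proj_norm_bounds hn0 hn2 hax1 hax2
    obtain ⟨hn_l', hn_u'⟩ := gkb_proj_norm_bounds hn0' hn2' hax1' hax2'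
    have hp0 : 0 ≤ n' * n := mul_nonneg hn0' hn0
    obtain ⟨hp_l, hp_u⟩ := gkb_proj_prod_bounds hn_l hn_u hn_l' hn_u'
    obtain ⟨haa_l, haa_u⟩ := gkb_height_prod_bounds hax1 hax2 hax1' hax2'
    have h38 := gkb_lt_cos_three_pi_div_eight
    have h25 := gkb_cos_two_pi_div_five_lt
    have hww' : ⟪u x', u x⟫ ≤ 253 / 500 := by
      rcases hww with h | h
      · linarith
      · exact h.2
    refine ⟨?_, ?_⟩
    · -- `cos Δ ≤ 0.262 / 0.7439 < 0.36 < cos (3π/8)`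
      have hCu : C < 0.36 := gkb_cos_lt_of_mul_le hp_l (by linarith)
      linarith
    · rcases hww with hfar | hbond
      · -- far partner: `n' n cos Δ ≤ 1/50 − a'a < 0`
        right
        exact gkb_cos_neg_of_mul_neg hp0 (by linarith)
      · -- bonded partner: `cos Δ ≥ 0.2379 / 0.7561 > 0.3091 > cos (2π/5)`
        left
        have hCl : 0.3091 < C := gkb_lt_cos_of_le_mul hp0 hp_u (by linarith [hbond.1])
        linarith
  -- sort five bonded partners by azimuth and conclude
  have hinj : Set.InjOn (fun x => Complex.arg (z (u x))) S := by
    intro x hx x' hx' heq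
    by_contra hne
    have h := (hpair x hx x' hx' hne).1
    simp only at heq
    rw [heq, sub_self, Real.cos_zero] at h
    linarith [Real.cos_le_one (3 * π / 8)]
  set Args : Finset ℝ := S.image (fun x => Complex.arg (z (u x))) with hArgs
  have hcard : Args.card = 5 := by rw [hArgs, Finset.card_image_of_injOn hinj, hScard]
  set θ := Args.orderEmbOfFin hcard with hθ
  have hθmem : ∀ i, θ i ∈ Args := fun i => Finset.orderEmbOfFin_mem Args hcard i
  have hpre : ∀ i, ∃ x ∈ S, Complex.arg (z (u x)) = θ i := fun i => by
    simpa [hArgs] using hθmem i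
  choose w hwS hwθ using hpre
  have hne : ∀ i j : Fin 5, i ≠ j → w i ≠ w j := by
    intro i j hij h
    apply hij
    apply θ.injective
    rw [← hwθ i, ← hwθ j, h]
  refine gkb_five_gaps_false θ.strictMono ?_ ?_ ?_
  · intro i
    rw [← hwθ i]
    exact ⟨Complex.neg_pi_lt_arg _, Complex.arg_le_pi _⟩
  · intro i j hij
    rw [← hwθ i, ← hwθ j]
    exact (hpair _ (hwS i) _ (hwS j) (hne i j hij)).1
  · intro i j hij
    rw [← hwθ i, ← hwθ j]
    exact (hpair _ (hwS i) _ (hwS j) (hne i j hij)).2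

end Summit.AtomisticToContinuum.Crystallization.Theorems

end
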